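import Mathlib

/-!
# Route `RigidCore` — objects of line `generic-period-fibre` (crux `SchanuelOnLogFreeCore`) and their elementary API

Objects posited by line `generic-period-fibre` of crux `stmt-Schanuel-0970`
(`Summit.Schanuel.Schanuel.Theses.RigidCore.SchanuelOnLogFreeCore`, Schanuel's conjecture on the
log-free core `C_EA`; skeleton `Summits/Schanuel/Schanuel/Cruxes/SchanuelOnLogFreeCore/Lines/generic-period-fibre.lean`),
with the elementary API that the proof files `RigidCoreSchanuelOnLogFreeCoreTermGerm.lean`
(registered stub `stub_termGerm`) and `RigidCoreSchanuelOnLogFreeCoreGenericFibre.lean` (registered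
stubs `stub_noHiddenConstants`, `stub_genericFibre`) import:

* `eaFibre ω` — the **EA-fibre** `F_ω`, the smallest intermediate field of `ℂ/ℚ` containing `ω`,
  closed under `exp` and relatively algebraically closed in `ℂ`; VERBATIM the `sInf` inlined in the
  line's stubs (`rfl` bridges). `eaFibre (2πi)` is the log-free core `C_EA` of the crux (the same
  `sInf` as `Summit.Schanuel.Schanuel.Theorems.AclSubsetLogFreeCore.Negative.logFreeCore`, the kernel
  fibre; the family is needed because the line MOVES the parameter `ω`).
* `kernelFreeCore` — the **kernel-free core** `M = ℚ^{EA} ∩ ℂ` (smallest `exp`-closed, relatively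
  algebraically closed subfield; VERBATIM the `sInf` of stubs A/B), with `M ≤ F_ω`, and `F_a ≤ M`
  for algebraic `a` (`stub_eaFibre_le_kernelFreeCore`, registered stub D of the line, proved here).
* `IsLogFreeTerm U t` — **log-free terms** on an open set `U ⊆ ℂ`: the inductively generated class
  of functions `ℂ → ℂ` built from the coordinate and the rational constants by `+`, `×`, inverses
  of non-vanishing members, `exp ∘ ·`, and IMPLICIT ROOTS of monic polynomials with coefficients in
  the class (simple roots on `U`) — the syntactic object behind "every element of `F_ω` is the
  value at `ω` of a log-free exponential-algebraic term germ" (idea card `generic-period-fibre`,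
  NoHiddenConstants; cf. Kirby, *Exponential algebraicity in exponential fields*, Bull. LMS 42
  (2010) §3 for the e/a-closure it mirrors). A predicate on total functions with a set parameter
  (only values on `U` matter), so Mathlib's `deriv`/`DifferentiableOn`/`HasDerivAt` apply without a
  germ quotient. Elementary API: restriction (`mono`), complex differentiability, derived
  constructions (`zero/one/natCast/neg/sub/pow/sum`, the `∂_Y`-expression `rootDeriv`), and
  VALUES IN THE FIBRES (`apply_mem_eaFibre`: `t z ∈ F_z` for `z ∈ U`).

The analytic theorems about these objects (closure under `d/dz`, the E-chain rule, the
representation theorem `F_ω = {term values at ω}`, NoHiddenConstants, the generic-fibre theorem)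
are in the two proof files named above. Sources: idea card `generic-period-fibre`; Kirby 2010 §3–4.
-/

noncomputable section

namespace Summit.Schanuel.Schanuel.Theorems.RigidCore

open Complex
open scoped BigOperators Topology

/-! ## Definitions -/

/-- The **EA-fibre** `F_ω`: the smallest intermediate field of `ℂ/ℚ` containing `ω` that is closed
under `exp` and relatively algebraically closed in `ℂ` (verbatim the `sInf` inlined in the stubs of
line `generic-period-fibre`; `F_{2πi}` is the log-free core `C_EA` of crux
`RigidCore.SchanuelOnLogFreeCore`). -/
def eaFibre (ω : ℂ) : IntermediateField ℚ ℂ :=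
  sInf {K : IntermediateField ℚ ℂ | ω ∈ K ∧ (∀ w ∈ K, Complex.exp w ∈ K) ∧
    ∀ w : ℂ, IsAlgebraic K w → w ∈ K}

/-- The **kernel-free core** `M = ℚ^{EA} ∩ ℂ` (Macintyre's sector): the smallest intermediate
field of `ℂ/ℚ` closed under `exp` and relatively algebraically closed in `ℂ` — no period adjoined.
VERBATIM the `sInf` inlined in stubs A (`stub_schanuelOnKernelFreeCore`) and B
(`stub_periodGenericOverCore`) of the line; `kernelFreeCore ≤ eaFibre ω` for every `ω`. -/
def kernelFreeCore : IntermediateField ℚ ℂ :=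
  sInf {K : IntermediateField ℚ ℂ | (∀ w ∈ K, Complex.exp w ∈ K) ∧ ∀ w : ℂ, IsAlgebraic K w → w ∈ K}

/-- **Log-free terms on an open set `U ⊆ ℂ`.** The smallest class of functions `ℂ → ℂ` containing
the coordinate `z ↦ z` and the rational constants, closed under pointwise `+`, `×`, inverses of
members that do not vanish on `U`, post-composition with `exp`, and IMPLICIT ROOTS: a function `g`,
complex-differentiable on `U`, which on `U` is a root of a monic polynomial
`Y ^ d + Σ_{i<d} aᵢ Yⁱ` with coefficients `aᵢ` in the class and stays a SIMPLE root there
(`d • g^{d-1} + Σ i • aᵢ • g^{i-1} ≠ 0` on `U`; the `i = 0` summand vanishes). No logarithm and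
no other transcendental function is a generator ("log-free"). Only the values on `U` matter. -/
inductive IsLogFreeTerm (U : Set ℂ) : (ℂ → ℂ) → Prop
  /-- the coordinate function `z ↦ z` -/
  | id : IsLogFreeTerm U (fun z => z)
  /-- rational constants -/
  | const (q : ℚ) : IsLogFreeTerm U (fun _ => (q : ℂ))
  /-- pointwise sum -/
  | add {f g : ℂ → ℂ} : IsLogFreeTerm U f → IsLogFreeTerm U g →
      IsLogFreeTerm U (fun z => f z + g z)
  /-- pointwise product -/
  | mul {f g : ℂ → ℂ} : IsLogFreeTerm U f → IsLogFreeTerm U g →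
      IsLogFreeTerm U (fun z => f z * g z)
  /-- inverse of a member that does not vanish on `U` -/
  | inv {f : ℂ → ℂ} : IsLogFreeTerm U f → (∀ z ∈ U, f z ≠ 0) →
      IsLogFreeTerm U (fun z => (f z)⁻¹)
  /-- post-composition with the complex exponential -/
  | exp {f : ℂ → ℂ} : IsLogFreeTerm U f → IsLogFreeTerm U (fun z => Complex.exp (f z))
  /-- implicit root: `g`, differentiable on `U`, is on `U` a SIMPLE root of the monic polynomial
  `Y ^ d + Σ_{i<d} aᵢ Yⁱ` whose coefficients `aᵢ` are log-free terms on `U` -/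
  | root {d : ℕ} {a : Fin d → ℂ → ℂ} {g : ℂ → ℂ} :
      (∀ i, IsLogFreeTerm U (a i)) → DifferentiableOn ℂ g U →
      (∀ z ∈ U, g z ^ d + ∑ i : Fin d, a i z * g z ^ (i : ℕ) = 0) →
      (∀ z ∈ U, (d : ℂ) * g z ^ (d - 1) +
        ∑ i : Fin d, ((i : ℕ) : ℂ) * a i z * g z ^ ((i : ℕ) - 1) ≠ 0) →
      IsLogFreeTerm U g

/-! ## Elementary closure properties -/

namespace IsLogFreeTerm

variable {U V : Set ℂ}

/-- Restriction to a smaller set. -/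
theorem mono {t : ℂ → ℂ} (ht : IsLogFreeTerm U t) (hVU : V ⊆ U) : IsLogFreeTerm V t := by
  induction ht with
  | id => exact IsLogFreeTerm.id
  | const q => exact IsLogFreeTerm.const q
  | add _ _ ihf ihg => exact ihf.add ihg
  | mul _ _ ihf ihg => exact ihf.mul ihg
  | inv _ hne ih => exact ih.inv fun z hz => hne z (hVU hz)
  | exp _ ih => exact ih.exp
  | root _ hg hroot hsep ih =>
    exact IsLogFreeTerm.root ih (hg.mono hVU) (fun z hz => hroot z (hVU hz))
      (fun z hz => hsep z (hVU hz))

/-- Log-free terms are complex-differentiable on `U`. -/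
theorem differentiableOn {t : ℂ → ℂ} (ht : IsLogFreeTerm U t) : DifferentiableOn ℂ t U := by
  induction ht with
  | id => exact differentiableOn_id
  | const q => exact differentiableOn_const _
  | add _ _ ihf ihg => exact ihf.add ihg
  | mul _ _ ihf ihg => exact ihf.mul ihg
  | inv _ hne ih => exact ih.inv hne
  | exp _ ih => exact ih.cexp
  | root _ hg _ _ _ => exact hg

/-- Log-free terms on an open set are differentiable at each of its points. -/
theorem differentiableAt (hU : IsOpen U) {t : ℂ → ℂ} (ht : IsLogFreeTerm U t) {z : ℂ}
    (hz : z ∈ U) : DifferentiableAt ℂ t z :=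
  ht.differentiableOn.differentiableAt (hU.mem_nhds hz)

/-- Log-free terms on an open set are continuous at each of its points. -/
theorem continuousAt (hU : IsOpen U) {t : ℂ → ℂ} (ht : IsLogFreeTerm U t) {z : ℂ}
    (hz : z ∈ U) : ContinuousAt t z :=
  (ht.differentiableAt hU hz).continuousAt

/-- The constant `0`. -/
theorem zero : IsLogFreeTerm U (fun _ => (0 : ℂ)) := by
  simpa using IsLogFreeTerm.const (U := U) 0

/-- The constant `1`. -/
theorem one : IsLogFreeTerm U (fun _ => (1 : ℂ)) := by
  simpa using IsLogFreeTerm.const (U := U) 1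

/-- Natural-number constants. -/
theorem natCast (n : ℕ) : IsLogFreeTerm U (fun _ => (n : ℂ)) := by
  simpa using IsLogFreeTerm.const (U := U) n

/-- Negation. -/
theorem neg {f : ℂ → ℂ} (hf : IsLogFreeTerm U f) : IsLogFreeTerm U (fun z => -f z) := by
  have h := (IsLogFreeTerm.const (U := U) (-1)).mul hf
  simpa using h

/-- Subtraction. -/
theorem sub {f g : ℂ → ℂ} (hf : IsLogFreeTerm U f) (hg : IsLogFreeTerm U g) :
    IsLogFreeTerm U (fun z => f z - g z) := by
  simpa [sub_eq_add_neg] using hf.add hg.neg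

/-- Powers. -/
theorem pow {f : ℂ → ℂ} (hf : IsLogFreeTerm U f) (n : ℕ) : IsLogFreeTerm U (fun z => f z ^ n) := by
  induction n with
  | zero => simpa using IsLogFreeTerm.one (U := U)
  | succ n ih => simpa [pow_succ] using ih.mul hf

/-- Finite sums. -/
theorem sum {ι : Type*} (s : Finset ι) {f : ι → ℂ → ℂ} (hf : ∀ i ∈ s, IsLogFreeTerm U (f i)) :
    IsLogFreeTerm U (fun z => ∑ i ∈ s, f i z) := by
  classical
  induction s using Finset.induction_on with
  | empty => simpa using IsLogFreeTerm.zero (U := U)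
  | insert a s ha ih =>
    have h := (hf a (Finset.mem_insert_self a s)).add
      (ih fun i hi => hf i (Finset.mem_insert_of_mem hi))
    simpa [Finset.sum_insert ha] using h

/-- The `∂_Y`-expression of a root node is a log-free term. -/
theorem rootDeriv {d : ℕ} {a : Fin d → ℂ → ℂ} {g : ℂ → ℂ} (ha : ∀ i, IsLogFreeTerm U (a i))
    (hg : IsLogFreeTerm U g) :
    IsLogFreeTerm U (fun z => (d : ℂ) * g z ^ (d - 1) +
      ∑ i : Fin d, ((i : ℕ) : ℂ) * a i z * g z ^ ((i : ℕ) - 1)) :=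
  ((IsLogFreeTerm.natCast d).mul (hg.pow (d - 1))).add
    (IsLogFreeTerm.sum Finset.univ fun i _ =>
      ((IsLogFreeTerm.natCast (i : ℕ)).mul (ha i)).mul (hg.pow ((i : ℕ) - 1)))

end IsLogFreeTerm

/-! ## The EA-fibres -/

/-- `ω ∈ F_ω`. -/
theorem mem_eaFibre_self (ω : ℂ) : ω ∈ eaFibre ω := by
  rw [eaFibre, IntermediateField.mem_sInf]
  exact fun K hK => hK.1

/-- The EA-fibre is closed under `exp`. -/
theorem exp_mem_eaFibre {ω w : ℂ} (hw : w ∈ eaFibre ω) : Complex.exp w ∈ eaFibre ω := by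
  rw [eaFibre, IntermediateField.mem_sInf] at hw ⊢
  exact fun K hK => hK.2.1 w (hw K hK)

/-- The EA-fibre is relatively algebraically closed in `ℂ`. -/
theorem mem_eaFibre_of_isAlgebraic {ω w : ℂ} (hw : IsAlgebraic (eaFibre ω) w) : w ∈ eaFibre ω := by
  rw [eaFibre, IntermediateField.mem_sInf]
  intro K hK
  have hle : eaFibre ω ≤ K := sInf_le hK
  letI : Algebra (↥(eaFibre ω)) (↥K) := (IntermediateField.inclusion hle).toRingHom.toAlgebra
  haveI : IsScalarTower (↥(eaFibre ω)) (↥K) ℂ := IsScalarTower.of_algebraMap_eq (fun _ => rfl)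
  exact hK.2.2 w (hw.tower_top (↥K))

/-- `F_ω ≤ K` for every `exp`-closed, relatively algebraically closed `K ∋ ω` (it is an `sInf`). -/
theorem eaFibre_le {ω : ℂ} {K : IntermediateField ℚ ℂ} (hω : ω ∈ K) (hexp : ∀ w ∈ K, Complex.exp w ∈ K)
    (halg : ∀ w : ℂ, IsAlgebraic K w → w ∈ K) : eaFibre ω ≤ K :=
  sInf_le ⟨hω, hexp, halg⟩

/-- Rational numbers lie in every fibre. -/
theorem ratCast_mem_eaFibre (ω : ℂ) (q : ℚ) : (q : ℂ) ∈ eaFibre ω := by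
  have h := (eaFibre ω).algebraMap_mem q
  rwa [eq_ratCast] at h

/-- A root of a monic polynomial with coefficients in the fibre lies in the fibre. -/
theorem mem_eaFibre_of_root {ω : ℂ} {d : ℕ} {c : Fin d → ℂ} (hc : ∀ i, c i ∈ eaFibre ω) {w : ℂ}
    (hw : w ^ d + ∑ i : Fin d, c i * w ^ (i : ℕ) = 0) : w ∈ eaFibre ω := by
  set K := eaFibre ω
  let c' : Fin d → K := fun i => ⟨c i, hc i⟩
  let p : Polynomial K := Polynomial.X ^ d + ∑ i : Fin d, Polynomial.C (c' i) * Polynomial.X ^ (i : ℕ)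
  have hp : p.Monic := Polynomial.monic_X_pow_add (Polynomial.degree_sum_fin_lt c')
  refine mem_eaFibre_of_isAlgebraic ⟨p, hp.ne_zero, ?_⟩
  simp only [p, c', map_add, map_pow, Polynomial.aeval_X, map_sum, map_mul, Polynomial.aeval_C,
    IntermediateField.algebraMap_apply]
  exact hw

namespace IsLogFreeTerm

variable {U : Set ℂ}

/-- **Values of log-free terms lie in the fibres**: `t z ∈ F_z` for every `z ∈ U`. -/
theorem apply_mem_eaFibre {t : ℂ → ℂ} (ht : IsLogFreeTerm U t) {z : ℂ} (hz : z ∈ U) :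
    t z ∈ eaFibre z := by
  induction ht with
  | id => exact mem_eaFibre_self z
  | const q => exact ratCast_mem_eaFibre z q
  | add _ _ ihf ihg => exact add_mem ihf ihg
  | mul _ _ ihf ihg => exact mul_mem ihf ihg
  | inv _ _ ih => exact inv_mem ih
  | exp _ ih => exact exp_mem_eaFibre ih
  | root _ _ hroot _ ih => exact mem_eaFibre_of_root ih (hroot z hz)

end IsLogFreeTerm

/-! ## The kernel-free core -/

/-- The kernel-free core is closed under `exp`. -/
theorem exp_mem_kernelFreeCore {w : ℂ} (hw : w ∈ kernelFreeCore) : Complex.exp w ∈ kernelFreeCore := by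
  rw [kernelFreeCore, IntermediateField.mem_sInf] at hw ⊢
  exact fun K hK => hK.1 w (hw K hK)

/-- The kernel-free core is relatively algebraically closed in `ℂ`. -/
theorem mem_kernelFreeCore_of_isAlgebraic {w : ℂ} (hw : IsAlgebraic kernelFreeCore w) :
    w ∈ kernelFreeCore := by
  rw [kernelFreeCore, IntermediateField.mem_sInf]
  intro K hK
  have hle : kernelFreeCore ≤ K := sInf_le hK
  letI : Algebra (↥kernelFreeCore) (↥K) := (IntermediateField.inclusion hle).toRingHom.toAlgebra
  haveI : IsScalarTower (↥kernelFreeCore) (↥K) ℂ := IsScalarTower.of_algebraMap_eq (fun _ => rfl)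
  exact hK.2 w (hw.tower_top (↥K))

/-- `M ≤ K` for every `exp`-closed, relatively algebraically closed `K` (it is an `sInf`). -/
theorem kernelFreeCore_le {K : IntermediateField ℚ ℂ} (hexp : ∀ w ∈ K, Complex.exp w ∈ K)
    (halg : ∀ w : ℂ, IsAlgebraic K w → w ∈ K) : kernelFreeCore ≤ K :=
  sInf_le ⟨hexp, halg⟩

/-- `M ≤ F_ω` for every `ω`. -/
theorem kernelFreeCore_le_eaFibre (ω : ℂ) : kernelFreeCore ≤ eaFibre ω :=
  kernelFreeCore_le (fun _ hw => exp_mem_eaFibre hw) fun _ hw => mem_eaFibre_of_isAlgebraic hw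

/-- Algebraic numbers lie in `M`. -/
theorem mem_kernelFreeCore_of_isAlgebraic_rat {a : ℂ} (ha : IsAlgebraic ℚ a) : a ∈ kernelFreeCore :=
  mem_kernelFreeCore_of_isAlgebraic (ha.tower_top (↥kernelFreeCore))

/-- The fibre at an algebraic point is (contained in) the kernel-free core. -/
theorem eaFibre_le_kernelFreeCore_of_isAlgebraic {a : ℂ} (ha : IsAlgebraic ℚ a) :
    eaFibre a ≤ kernelFreeCore :=
  eaFibre_le (mem_kernelFreeCore_of_isAlgebraic_rat ha) (fun _ hw => exp_mem_kernelFreeCore hw)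
    fun _ hw => mem_kernelFreeCore_of_isAlgebraic hw

/-- **Stub D of line `generic-period-fibre`** (registered on `stmt-Schanuel-0970`, signature
verbatim): for algebraic `a`, `F_a ≤ M` — the fibre at an algebraic point is the kernel-free core.
`eaFibre`/`kernelFreeCore` are these `sInf`s by `rfl`. -/
theorem stub_eaFibre_le_kernelFreeCore :
    ∀ a : ℂ, IsAlgebraic ℚ a →
      (sInf {K : IntermediateField ℚ ℂ | a ∈ K ∧ (∀ w ∈ K, Complex.exp w ∈ K) ∧
        ∀ w : ℂ, IsAlgebraic K w → w ∈ K} : IntermediateField ℚ ℂ) ≤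
      (sInf {K : IntermediateField ℚ ℂ | (∀ w ∈ K, Complex.exp w ∈ K) ∧
        ∀ w : ℂ, IsAlgebraic K w → w ∈ K} : IntermediateField ℚ ℂ) :=
  fun _ ha => eaFibre_le_kernelFreeCore_of_isAlgebraic ha

end Summit.Schanuel.Schanuel.Theorems.RigidCore

end
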